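import Mathlib
import Summits.Ventures.PercRepro2.Tail2DBlockCalc
import Summits.Ventures.PercRepro2.Tail2DHarrisSP
import Summits.Ventures.PercRepro2.Tail2DFlowOneBlocks
import Summits.Ventures.PercRepro2.Tail2DFlowOneStep01
import Summits.Ventures.PercRepro2.Tail2DParFin
import Summits.Ventures.PercRepro2.Tail2DParFinFlip
import Summits.Ventures.PercRepro2.Tail2DParFinTop
import Summits.Ventures.PercRepro2.Tail2DParFinDiag
import Summits.Ventures.PercRepro2.Tail2DParFinCount
import Summits.Ventures.PercRepro2.Tail2DParFinRelax
import Summits.Ventures.PercRepro2.Tail2DParFinSubTop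
import Summits.Ventures.PercRepro2.Tail2DParFinSubTopB
import Summits.Ventures.PercRepro2.Tail2DParFinFibres
import Summits.Ventures.PercRepro2.Tail2DOneChange
import Summits.Ventures.PercRepro2.Tail2DOneChangeB
import Summits.Ventures.PercRepro2.Tail2DOneChangeC
import Summits.Ventures.PercRepro2.Tail2DFourIdent
import Summits.Ventures.PercRepro2.Tail2DSevIdent40
import Summits.Ventures.PercRepro2.Tail2DSevIdent40S1
import Summits.Ventures.PercRepro2.Tail2DSevIdent40T1

/-!
# (SD) at `(4,0)` on `7` identical flow-one factors — the source and target identities and the theorem (Z)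
(seat mine-b, cell pub-perc-repro2; conjectures/MINE-B.md §44)
-/

namespace Summit.Ventures.PercRepro2.Tail2D

open V2Closure Finset

namespace IdentSev40

variable {Y : V2Closure.SP}

/-- **the source identity** -/
theorem ratesN_srcOK (hR : 0 < (rSet Y).card) : (ratesN Y).SrcOK (fun _ => Y) 4 0 := by
  intro w hw
  have h3 := nR_add_nB_add_nC 7 w
  obtain ⟨r, hr⟩ : ∃ r, nR 7 w = r := ⟨_, rfl⟩
  obtain ⟨b, hb⟩ : ∃ b, nB 7 w = b := ⟨_, rfl⟩
  have hr1 : 4 ≤ r := by have := hw.1; omega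
  have hb1 : 0 ≤ b := by have := hw.2; omega
  have hr2 : r ≤ 7 := by omega
  have hb2 : b ≤ 7 := by omega
  interval_cases r <;> interval_cases b <;> first | exact src_4_0 hR w hr hb | exact src_5_0 hR w hr hb | exact src_6_0 hR w hr hb | exact src_7_0 hR w hr hb | exact src_4_1 hR w hr hb | exact src_5_1 hR w hr hb | exact src_6_1 hR w hr hb | exact src_4_2 hR w hr hb | exact src_5_2 hR w hr hb | exact src_4_3 hR w hr hb | omega

/-- **the target identity** -/
theorem ratesN_tgtOK (hY : FlowOne Y) (hR : 0 < (rSet Y).card) : (ratesN Y).TgtOK (fun _ => Y) 4 0 := by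
  intro w0 ht
  have h3 := nR_add_nB_add_nC 7 w0
  obtain ⟨r, hr⟩ : ∃ r, nR 7 w0 = r := ⟨_, rfl⟩
  obtain ⟨b, hb⟩ : ∃ b, nB 7 w0 = b := ⟨_, rfl⟩
  have hr1 : 3 ≤ r := by have := ht.1; omega
  have hb1 : 1 ≤ b := by have := ht.2; omega
  have hr2 : r ≤ 7 := by omega
  have hb2 : b ≤ 7 := by omega
  interval_cases r <;> interval_cases b <;> first | exact tgt_3_1 hY hR w0 hr hb | exact tgt_4_1 hY hR w0 hr hb | exact tgt_5_1 hY hR w0 hr hb | exact tgt_6_1 hY hR w0 hr hb | exact tgt_3_2 hY hR w0 hr hb | exact tgt_4_2 hY hR w0 hr hb | exact tgt_5_2 hY hR w0 hr hb | exact tgt_3_3 hY hR w0 hr hb | exact tgt_4_3 hY hR w0 hr hb | exact tgt_3_4 hY hR w0 hr hb | omega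

/-- **(SD) at `(4,0)` on `7` identical factors** -/
theorem sdomZ_ident_Sev40 (hY : FlowOne Y) (hR : 0 < (rSet Y).card) : SDomZ (parFin 7 (fun _ => Y)) 4 0 :=
  sdomZ_of_oneChange (fun _ => hY) (fun _ => hR) (by norm_num) (ratesN Y) (ratesN_iota_nonneg hR)
    (ratesN_f_nonneg hR) (ratesN_x_nonneg hR) (ratesN_srcOK hR) (ratesN_tgtOK hY hR)

end IdentSev40

end Summit.Ventures.PercRepro2.Tail2D
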